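import Summits.AtomisticToContinuum.BoseEinsteinCondensation.Theorems.BECInsertionVarianceGroundStateAccessibleFKTrialStates
import Literature.MathematicalPhysics.QuantumManyBody.GroundState
import HarnessLib

/-!
# The Feynman–Kac ground state of a bounded pair potential is a ground state of the closed form

Helper for item `GroundStateAccessible` (stmt-AtomisticToContinuum-12069) of route `BECInsertionVariance`
(`Summit.AtomisticToContinuum.BoseEinsteinCondensation.Theses.BECInsertionVariance.GroundStateAccessible`):
the EXISTENCE half of the item for BOUNDED repulsive pair potentials.

`Literature/…/GroundState.lean` defines ground states variationally (`IsGroundState`: normalised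
minimisers of the closed Dirichlet form `closedEnergy`, the lower-semicontinuous envelope of the energy
from the symmetric `C¹` Dirichlet core) and THE nonnegative ground state `groundState v N L` by classical
choice, with junk value `0` when no nonnegative ground state exists; it deliberately proves no existence
theorem. `Literature/…/GroundStateFeynmanKac*.lean` constructs, for BOUNDED measurable `v`, `N ≥ 1`,
`L > 0`, the Perron–Frobenius–Feynman–Kac ground state (`GroundStateFeynmanKac_holds`: a continuous
witness of `IsGroundStateFK`, strictly positive on the open box), and `GroundState.lean` records that the
two "are expected to coincide; not proved here". This file proves the bridge:

* `isGroundState_of_isGroundStateFK` — a CONTINUOUS Feynman–Kac ground state is a ground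
  state of the closed form: by `exists_trialState_near` it is the uniform (hence `L²`) limit of
  symmetric `C¹` Dirichlet trial states with energies `→ E₀`, and `IsGroundState.of_tendstoL2` applies;
* `exists_nonneg_isGroundState_of_bounded` — for bounded measurable `v`, `N ≥ 1`, `L > 0` a
  nonnegative ground state exists (indeed a continuous one, strictly positive on the box, which is
  moreover THE Feynman–Kac ground state `fkGroundState v N L`);
* `isGroundState_groundState_of_bounded`, `lintegral_groundState_sq_of_bounded` — hence
  `groundState v N L` is in its good branch: a normalised ground state, not the junk `0`.

What is NOT here: uniqueness of the closed-form ground state (so `groundState` need not be the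
Feynman–Kac one pointwise/a.e.; that identification is the stability chain of crux
`GroundStateRigidity`, stmt-AtomisticToContinuum-9072), and anything about unbounded `v` / hard cores.

References: Reed–Simon IV §XIII.12 (ground state = bottom eigenvector; Thm XIII.47), Chung–Zhao
(1995) Thm 3.27 / Prop 3.29 (the variational characterisation of the top of the spectrum of the
Feynman–Kac semigroup), Kato VI §1.3–1.4 (closed forms and their cores).
-/

noncomputable section

open MeasureTheory Filter Set
open scoped ENNReal NNReal Topology

namespace Summit.AtomisticToContinuum.BoseEinsteinCondensation.Theorems.BECInsertionVariance

open Literature.MathematicalPhysics.QuantumManyBody.BoseGas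

variable {N : ℕ}

/-- The integrated eigen-relation of a Feynman–Kac ground state, in real form:
`∫ Ψ₀ · e^{-tH_N} Ψ₀ = e^{-E₀ t}` (so in particular `e^{-E₀t} ≤ ⟨Ψ₀, e^{-tH_N}Ψ₀⟩`).
[cite: GlimmJaffeQP1987, §3.3 Thm 3.3.2 and §3.4 (3.4.2)] -/
theorem integral_mul_fkReal_eq_of_isGroundStateFK {v : ℝ → ℝ≥0∞} (hv : Measurable v) {L : ℝ}
    {Ψ₀ : Config N → ℝ} (h : IsGroundStateFK v L Ψ₀) (hnorm : ∫ X, Ψ₀ X ^ 2 = 1)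
    {t : ℝ} (ht : 0 < t) :
    ∫ X, Ψ₀ X * fkReal v L t Ψ₀ X =
      Real.exp (-((groundStateEnergy v N L).toReal * t)) := by
  have hpt : ∀ X, Ψ₀ X * fkReal v L t Ψ₀ X =
      Real.exp (-((groundStateEnergy v N L).toReal * t)) * Ψ₀ X ^ 2 := by
    intro X
    rw [fkReal_eq_toReal_fkSemigroup hv L t h.measurable h.nonneg X, h.eigen t ht.le X,
      ENNReal.toReal_ofReal (mul_nonneg (Real.exp_pos _).le (h.nonneg X))]
    ring
  simp_rw [hpt]
  rw [integral_const_mul, hnorm, mul_one]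

/-- The normalisation of a Feynman–Kac ground state as a Bochner integral: `∫ Ψ₀² = 1`, for a
continuous witness. [folklore] -/
theorem integral_sq_eq_one_of_isGroundStateFK {v : ℝ → ℝ≥0∞} {L : ℝ} {Ψ₀ : Config N → ℝ}
    (h : IsGroundStateFK v L Ψ₀) (hcont : Continuous Ψ₀) : ∫ X, Ψ₀ X ^ 2 = 1 := by
  have hcs : HasCompactSupport Ψ₀ :=
    HasCompactSupport.intro (isCompact_closedBall (0 : Config N) (3 * |L|))
      fun X hX => h.eq_zero X fun hb => hX (boxN_subset_closedBall N L hb)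
  have hsq : Integrable (fun X => Ψ₀ X ^ 2) volume := (hcont.memLp_of_hasCompactSupport hcs).integrable_sq
  have h1 : ∫⁻ X, ENNReal.ofReal (Ψ₀ X ^ 2) = 1 := by
    rw [← h.norm_eq]
    exact lintegral_congr fun X => ENNReal.ofReal_pow (h.nonneg X) 2
  rw [← toReal_lintegral_sq hsq, h1, ENNReal.toReal_one]

/-- `(‖z‖₊ : ℝ≥0∞)² ≤ ofReal (ε²)` when `‖z‖ ≤ ε`. [folklore] -/
theorem coe_nnnorm_sq_le_ofReal_sq {z : ℂ} {ε : ℝ} (hz : ‖z‖ ≤ ε) :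
    ((‖z‖₊ : ℝ≥0∞)) ^ 2 ≤ ENNReal.ofReal (ε ^ 2) := by
  have hε : 0 ≤ ε := (norm_nonneg z).trans hz
  rw [← enorm_eq_nnnorm, ← ofReal_norm, ← ENNReal.ofReal_pow (norm_nonneg _)]
  exact ENNReal.ofReal_le_ofReal (pow_le_pow_left₀ (norm_nonneg _) hz 2)

/-- **A continuous Feynman–Kac ground state is a ground state of the closed Dirichlet form.** For
`L > 0`, measurable `v ≤ C` and a CONTINUOUS witness `Ψ₀` of `IsGroundStateFK v L`, the
complexification of `Ψ₀` satisfies `IsGroundState v L`: it is measurable, Dirichlet, Bose symmetric,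
and the `L²`-limit of the symmetric `C¹` Dirichlet trial states of `exists_trialState_near` (with
`ε = 1/(k+1)`), whose energies are `≤ E₀ + 1/(k+1)`; hence `closedEnergy Ψ₀ ≤ E₀` and
`IsGroundState.of_tendstoL2` applies (`E₀ < ⊤` is part of `IsGroundStateFK`).
[cite: ChungZhao1995, Thm 3.27 and Prop 3.29 (81)] -/
theorem isGroundState_of_isGroundStateFK {v : ℝ → ℝ≥0∞} (hv : Measurable v) {C : ℝ≥0}
    (hC : ∀ r, v r ≤ C) {L : ℝ} (hL : 0 < L) {Ψ₀ : Config N → ℝ} (h : IsGroundStateFK v L Ψ₀)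
    (hcont : Continuous Ψ₀) : IsGroundState v L (fun X => (Ψ₀ X : ℂ)) := by
  set E₀ := groundStateEnergy v N L with hE₀
  have hEtop : E₀ ≠ ⊤ := h.energy_ne_top
  have hnorm : ∫ X, Ψ₀ X ^ 2 = 1 := integral_sq_eq_one_of_isGroundStateFK h hcont
  have heig : ∀ t : ℝ, 0 < t →
      Real.exp (-(E₀.toReal * t)) ≤ ∫ X, Ψ₀ X * fkReal v L t Ψ₀ X :=
    fun t ht => (integral_mul_fkReal_eq_of_isGroundStateFK hv h hnorm ht).ge
  -- the approximating trial states
  have hex : ∀ k : ℕ, ∃ Ψ : TrialState N L,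
      energy v Ψ ≤ ENNReal.ofReal E₀.toReal + ENNReal.ofReal (1 / ((k : ℝ) + 1)) ∧
        ∀ X, ‖Ψ.ψ X - (Ψ₀ X : ℂ)‖ ≤ 1 / ((k : ℝ) + 1) := fun k =>
    exists_trialState_near hL hv hC hcont h.eq_zero h.nonneg h.symm hnorm heig
      (ε := 1 / ((k : ℝ) + 1)) (by positivity)
  choose Φ hΦE hΦnear using hex
  have hofE : ENNReal.ofReal E₀.toReal = E₀ := ENNReal.ofReal_toReal hEtop
  -- `L²` convergence from uniform convergence on the box
  have hεlim : Tendsto (fun k : ℕ => 1 / ((k : ℝ) + 1)) atTop (𝓝 0) :=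
    tendsto_one_div_add_atTop_nhds_zero_nat
  have hL2 : TendstoL2 Φ (fun X => (Ψ₀ X : ℂ)) := by
    have hbound : ∀ k, ∫⁻ X, ((‖(Φ k).ψ X - (Ψ₀ X : ℂ)‖₊ : ℝ≥0∞)) ^ 2 ≤
        ENNReal.ofReal ((1 / ((k : ℝ) + 1)) ^ 2) * volume (boxN N L) := by
      intro k
      have hpt : ∀ X, ((‖(Φ k).ψ X - (Ψ₀ X : ℂ)‖₊ : ℝ≥0∞)) ^ 2 ≤
          (boxN N L).indicator (fun _ => ENNReal.ofReal ((1 / ((k : ℝ) + 1)) ^ 2)) X := by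
        intro X
        by_cases hX : X ∈ boxN N L
        · rw [indicator_of_mem hX]
          exact coe_nnnorm_sq_le_ofReal_sq (hΦnear k X)
        · rw [indicator_of_notMem hX, (Φ k).eq_zero X hX, h.eq_zero X hX]
          simp
      calc ∫⁻ X, ((‖(Φ k).ψ X - (Ψ₀ X : ℂ)‖₊ : ℝ≥0∞)) ^ 2
          ≤ ∫⁻ X, (boxN N L).indicator (fun _ => ENNReal.ofReal ((1 / ((k : ℝ) + 1)) ^ 2)) X :=
            lintegral_mono hpt
        _ = ENNReal.ofReal ((1 / ((k : ℝ) + 1)) ^ 2) * volume (boxN N L) := by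
            rw [lintegral_indicator (measurableSet_boxN N L), setLIntegral_const]
    have hlim : Tendsto (fun k : ℕ => ENNReal.ofReal ((1 / ((k : ℝ) + 1)) ^ 2) * volume (boxN N L))
        atTop (𝓝 0) := by
      have h1 : Tendsto (fun k : ℕ => ENNReal.ofReal ((1 / ((k : ℝ) + 1)) ^ 2)) atTop (𝓝 0) := by
        have h2 := (hεlim.pow 2)
        rw [zero_pow two_ne_zero] at h2
        have h3 := ENNReal.tendsto_ofReal h2
        rwa [ENNReal.ofReal_zero] at h3
      have := ENNReal.Tendsto.mul_const h1 (Or.inr (volume_boxN_lt_top N L).ne)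
      rwa [zero_mul] at this
    exact tendsto_of_tendsto_of_tendsto_of_le_of_le tendsto_const_nhds hlim (fun _ => bot_le) hbound
  -- the energies
  have hlim : liminf (fun k => energy v (Φ k)) atTop ≤ E₀ := by
    have hg : Tendsto (fun k : ℕ => E₀ + ENNReal.ofReal (1 / ((k : ℝ) + 1))) atTop (𝓝 E₀) := by
      have h1 := ENNReal.tendsto_ofReal hεlim
      rw [ENNReal.ofReal_zero] at h1
      have := h1.const_add E₀
      rwa [add_zero] at this
    calc liminf (fun k => energy v (Φ k)) atTop
        ≤ liminf (fun k : ℕ => E₀ + ENNReal.ofReal (1 / ((k : ℝ) + 1))) atTop :=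
          liminf_le_liminf (Eventually.of_forall fun k => by
            have := hΦE k; rwa [hofE] at this)
      _ = E₀ := hg.liminf_eq
  -- conclude
  refine IsGroundState.of_tendstoL2 (Complex.measurable_ofReal.comp h.measurable)
    (fun X hX => by simp [h.eq_zero X hX]) (fun σ X => by simp [h.symm σ X]) hEtop hL2 hlim

/-- **Existence of a nonnegative ground state for bounded pair potentials**, with the extra structure
the Feynman–Kac construction provides: for `N ≥ 1`, `L > 0` and a measurable BOUNDED repulsive pair
profile `v`, there is `Ψ₀ ≥ 0` that is a Feynman–Kac ground state, a ground state of the closed form,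
continuous, and strictly positive on the open box `Λ_L^N`.
[cite: ReedSimonIV1978, §XIII.12 Thms XIII.46–XIII.47] -/
theorem exists_isGroundStateFK_isGroundState {N : ℕ} {L : ℝ} {v : ℝ → ℝ≥0∞} (hN : 1 ≤ N)
    (hL : 0 < L) (hv : Measurable v) (hb : ∃ C : ℝ≥0, ∀ r, v r ≤ C) :
    ∃ Ψ₀ : Config N → ℝ, IsGroundStateFK v L Ψ₀ ∧ IsGroundState v L (fun X => (Ψ₀ X : ℂ)) ∧
      Continuous Ψ₀ ∧ ∀ X ∈ boxN N L, 0 < Ψ₀ X := by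
  obtain ⟨C, hC⟩ := hb
  obtain ⟨Ψ₀, hFK, hcont, hpos⟩ := GroundStateFeynmanKac_holds N L v hN hL hv ⟨C, hC⟩
  exact ⟨Ψ₀, hFK, isGroundState_of_isGroundStateFK hv hC hL hFK hcont, hcont, hpos⟩

/-- **Existence of a nonnegative ground state of the closed Dirichlet form for bounded pair
potentials** (`N ≥ 1`, `L > 0`, `v` measurable and bounded): the hypothesis of
`isGroundState_groundState` / `lintegral_groundState_sq` in `GroundState.lean`.
[cite: ReedSimonIV1978, §XIII.12 Thm XIII.47] -/
theorem exists_nonneg_isGroundState_of_bounded {N : ℕ} {L : ℝ} {v : ℝ → ℝ≥0∞} (hN : 1 ≤ N)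
    (hL : 0 < L) (hv : Measurable v) (hb : ∃ C : ℝ≥0, ∀ r, v r ≤ C) :
    ∃ Ψ₀ : Config N → ℝ, (∀ X, 0 ≤ Ψ₀ X) ∧ IsGroundState v L (fun X => (Ψ₀ X : ℂ)) := by
  obtain ⟨Ψ₀, hFK, hGS, -, -⟩ := exists_isGroundStateFK_isGroundState hN hL hv hb
  exact ⟨Ψ₀, hFK.nonneg, hGS⟩

/-- For bounded `v` (`N ≥ 1`, `L > 0`) the library's `groundState v N L` is a genuine ground state
(good branch of the classical choice). [cite: LSSY2005, §1.2 (1.17) and Ch. 7] -/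
theorem isGroundState_groundState_of_bounded {N : ℕ} {L : ℝ} {v : ℝ → ℝ≥0∞} (hN : 1 ≤ N)
    (hL : 0 < L) (hv : Measurable v) (hb : ∃ C : ℝ≥0, ∀ r, v r ≤ C) :
    IsGroundState v L (fun X => (groundState v N L X : ℂ)) :=
  isGroundState_groundState (exists_nonneg_isGroundState_of_bounded hN hL hv hb)

/-- For bounded `v` (`N ≥ 1`, `L > 0`) the library's `groundState v N L` is normalised, `∫ Ψ₀² = 1`.
[cite: LSSY2005, §1.2 (1.17)] -/
theorem lintegral_groundState_sq_of_bounded {N : ℕ} {L : ℝ} {v : ℝ → ℝ≥0∞} (hN : 1 ≤ N)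
    (hL : 0 < L) (hv : Measurable v) (hb : ∃ C : ℝ≥0, ∀ r, v r ≤ C) :
    ∫⁻ X, ENNReal.ofReal (groundState v N L X) ^ 2 = 1 :=
  lintegral_groundState_sq (exists_nonneg_isGroundState_of_bounded hN hL hv hb)

/-- For bounded `v` (`N ≥ 1`, `L > 0`) THE Feynman–Kac ground state `fkGroundState v N L` is a ground
state of the closed form, continuous and strictly positive on the open box.
[cite: ChungZhao1995, Thm 3.17] -/
theorem isGroundState_fkGroundState_of_bounded {N : ℕ} {L : ℝ} {v : ℝ → ℝ≥0∞} (hN : 1 ≤ N)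
    (hL : 0 < L) (hv : Measurable v) (hb : ∃ C : ℝ≥0, ∀ r, v r ≤ C) :
    IsGroundState v L (fun X => (fkGroundState v N L X : ℂ)) ∧ Continuous (fkGroundState v N L) ∧
      ∀ X ∈ boxN N L, 0 < fkGroundState v N L X := by
  obtain ⟨Ψ₀, hFK, hGS, hcont, hpos⟩ := exists_isGroundStateFK_isGroundState hN hL hv hb
  rw [← hFK.eq_fkGroundState]
  exact ⟨hGS, hcont, hpos⟩

end Summit.AtomisticToContinuum.BoseEinsteinCondensation.Theorems.BECInsertionVariance

end
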